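import Mathlib
import HarnessLib
import Summits.HubbardSuperconductivity.HubbardSuperconductivity.Theorems.KLProgrammeKLRegimeEngineTowerBlockIncrWt
import Summits.HubbardSuperconductivity.HubbardSuperconductivity.Theorems.KLProgrammeKLRegimeEngineTowerModelDefsPow

/-!
# Route `KLProgramme` — crux K3 ENGINE (stmt-HubbardSuperconductivity-20437 `KLRegimeEngineV17F2`), stub (b) / E1 interface (E2) in-tower route and located risk #17
# «(C2)-MOMENTS»: THE DEGREE-`Dw` WEIGHTED BORN SIZES OF A BLOCK INCREMENT IN THE RATE-DECOUPLED CARRIER `klWtPinnedSumPow` — the power-`Dw` twin of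
# `…EngineTowerBlockIncrWt` (one pinned leg, the other sectors summed; weight rate `jr` free)
# (recipe «(E2)-POW3-TRACK» item T5a, HOME/hubbard-kl-k3c3-p2/g19/E2-POW3-TRACK-RECIPE.md; cell gate-hubbard-kl, seat hubbard-kl-k3c3-p2 g19)

`…EngineTowerBlockIncrWt` (`klWtPinnedSumOf_klTowerIncr_le`) bounds the `klScaleWt_{J′}`-weighted one-pinned-leg sums of `Δ_k = klTowerIncr … d k` at `F_{J′}` by the two
weight-generic block doors `blockStep_ordersGe2_wt_le` / `blockStep_firstOrder_wt_le` (…EngineTowerBlockStepWt).  Here the SAME two doors run with the degree-`Dw` tree weight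
`klScaleWtPow L M β jr Dw` of a free rate `jr` (`isTreeWeight_klScaleWtPow`), and the left side is k3c2-p3 g10's rate-decoupled degree-`Dw` carrier
`klWtPinnedSumPow L M β μ K J′ jr Dw (2(q+1)) Δ_k i w″` (…EngineTowerModelDefsPow) — EXACTLY the quantity the #17-Z reader `shellRow_spaceMomentPow_le_of_klWtPinnedSumPow`
(…V8TwoLegSpaceMomentsFamilyDoor §3) takes with `T := Δ_k`, and the `B m′` input-size currency of the next block in a power-`Dw` law.  DEF-FREE.

* **`klWtPinnedSumPow_klTowerIncr_le (jr Dw)`** — `1 ≤ d`, `1 ≤ k`, `dk ≤ J′`, `Z^K_{Λ_{dk}} ≠ 0`; Gram `κ`; degree-`Dw` rate-`jr` weighted `α`, `(cr, cc)` and one-pinned-leg input sizes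
  `B m′` of `𝒱_{dk}` at `F_{dk−1}`; `ρ`, `θ < 1`, `N₀ ≥ 2` ⊢ in every even degree `2(q+1)` (two legs included) and at every pin,
  `klWtPinnedSumPow … J′ jr Dw (2(q+1)) Δ_k i w″ ≤ ε^{2q+1}·(graded RHS + binomial RHS)` — p-file verbatim with the weight swapped.
Composition of landed theorems; the block constants are HYPOTHESES (their degree-`Dw` suppliers are recipe items T3/T4, not in the tree); nothing asserts (E2), (X).3,
any stub, K3 or superconductivity.
References: BGM 2006 §2.7 (2.70)–(2.71a), §2.8 (2.76)–(2.84), §3 (3.5)–(3.6) [cite: BenfattoGiulianiMastropietro2006].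
-/

noncomputable section

namespace Summit.HubbardSuperconductivity.HubbardSuperconductivity.Theorems.EngineV8

set_option linter.dupNamespace false -- summit = problem name (single-conjunct summit), D-0017

open Real Finset Literature.MathematicalPhysics.QuantumLattice Literature.Probability.LatticeModels GrassmannAlgebra
open Summit.HubbardSuperconductivity.HubbardSuperconductivity.Theorems.KLProgrammeLegKernels
open Summit.HubbardSuperconductivity.HubbardSuperconductivity.Theorems.KLRegimeSplit
open Summit.HubbardSuperconductivity.HubbardSuperconductivity.Theorems.KLRegimeWick
open Summit.HubbardSuperconductivity.HubbardSuperconductivity.Theorems.TwoPointAssembly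
open Literature.Probability.LatticeModels.BattleFederbush

section Born

variable {L M : ℕ} [NeZero L] [NeZero M]

/-- **THE DEGREE-`Dw` RATE-`j` WEIGHTED ONE-PINNED-LEG SIZES OF A BLOCK INCREMENT** (`klWtPinnedSumPow` currency): binders of `klWtPinnedSumOf_klTowerIncr_le` with the
weight `klScaleWtPow L M β jr Dw` in place of `klScaleWt L M β J′`. [cite: BenfattoGiulianiMastropietro2006, (2.70)-(2.71a), (2.76)-(2.84), (3.5)-(3.6)] -/
theorem klWtPinnedSumPow_klTowerIncr_le {β : ℝ} (hβ : 0 < β) (U μ : ℝ) (K : TrigPolyC4v) (jr Dw : ℕ) {d k J' : ℕ} (hd : 1 ≤ d) (hk : 1 ≤ k) (hJ' : d * k ≤ J')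
    (hZ : hubbardEffPartitionFnCT L M β U μ 0 K (klScale klE0 (d * k)) ≠ 0)
    {κ : ℝ} (hκ : 0 < κ)
    (hGB : IsGramBoundedR ((sectorSubMatrix L M β (bgmFatMultiplier L M klE0 β (nambuXiCT L μ K) (d * k - 1))).transpose *
      hubbardCovSliceCT L M β μ 0 K (klScale klE0 (d * (k + 1))) (klScale klE0 (d * k)) *
        sectorSubMatrix L M β (bgmFatMultiplier L M klE0 β (nambuXiCT L μ K) (d * k - 1))) κ)
    (B : ℕ → ℝ) (hB0 : ∀ m', 0 ≤ B m')
    (hB : ∀ (m' : ℕ) (j : Fin (2 * m')) (w : SpaceTimeIdx L M × SectorLeg (sectorCount (d * k - 1))),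
      ∑ Y ∈ univ.filter (fun Y : Fin (2 * m') → SpaceTimeIdx L M × SectorLeg (sectorCount (d * k - 1)) => Y j = w),
        klScaleWtPow L M β jr Dw ((univ.image Y).image (latticeLegPos (2 * (2 * M)))) *
          ‖kernel ℂ (ExteriorAlgebra.map (Matrix.toLin' (sectorAnalysisMatrix L M β (klAnisoFamily L M β μ K klE0 (d * k - 1))))
            (klTowerInput L M β U μ K d k)) (2 * m') Y‖ ≤ B m')
    {α : ℝ} (hα : 0 < α)
    (hrow : ∀ X, ∑ Y, ‖((sectorSubMatrix L M β (bgmFatMultiplier L M klE0 β (nambuXiCT L μ K) (d * k - 1))).transpose *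
        hubbardCovSliceCT L M β μ 0 K (klScale klE0 (d * (k + 1))) (klScale klE0 (d * k)) *
          sectorSubMatrix L M β (bgmFatMultiplier L M klE0 β (nambuXiCT L μ K) (d * k - 1))) X Y‖ *
        klScaleWtPow L M β jr Dw {latticeLegPos (2 * (2 * M)) X, latticeLegPos (2 * (2 * M)) Y} ≤ α)
    (hcol : ∀ Y, ∑ X, ‖((sectorSubMatrix L M β (bgmFatMultiplier L M klE0 β (nambuXiCT L μ K) (d * k - 1))).transpose *
        hubbardCovSliceCT L M β μ 0 K (klScale klE0 (d * (k + 1))) (klScale klE0 (d * k)) *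
          sectorSubMatrix L M β (bgmFatMultiplier L M klE0 β (nambuXiCT L μ K) (d * k - 1))) X Y‖ *
        klScaleWtPow L M β jr Dw {latticeLegPos (2 * (2 * M)) X, latticeLegPos (2 * (2 * M)) Y} ≤ α)
    {ρ : ℝ} (hρ : 0 < ρ)
    (hθ : Real.exp 1 * α * normV (SpaceTimeIdx L M × SectorLeg (sectorCount (d * k - 1))) κ ρ
      (fun m' => imagTimeWeight β M ^ (2 * m') * B m') / κ ^ 2 < 1)
    {cr cc : ℝ} (hcc0 : 0 ≤ cc)
    (hrow' : ∀ X'', ∑ X', ‖(sectorAnalysisMatrix L M β (klAnisoFamily L M β μ K klE0 J') *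
        sectorSubMatrix L M β (bgmFatMultiplier L M klE0 β (nambuXiCT L μ K) (d * k - 1))) X'' X'‖ *
        klScaleWtPow L M β jr Dw {latticeLegPos (2 * (2 * M)) X'', latticeLegPos (2 * (2 * M)) X'} ≤ cr)
    (hcol' : ∀ X', ∑ X'', ‖(sectorAnalysisMatrix L M β (klAnisoFamily L M β μ K klE0 J') *
        sectorSubMatrix L M β (bgmFatMultiplier L M klE0 β (nambuXiCT L μ K) (d * k - 1))) X'' X'‖ *
        klScaleWtPow L M β jr Dw {latticeLegPos (2 * (2 * M)) X'', latticeLegPos (2 * (2 * M)) X'} ≤ cc)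
    {N₀ : ℕ} (hN₀ : 2 ≤ N₀) (q : ℕ) (i : Fin (2 * (q + 1))) (w'' : SpaceTimeIdx L M × SectorLeg (sectorCount J')) :
    klWtPinnedSumPow L M β μ K J' jr Dw (2 * (q + 1)) (klTowerIncr L M β U μ K d k) i w'' ≤
      imagTimeWeight β M ^ (2 * q + 1) *
        (cr * cc ^ (2 * q + 1) *
          (∑ n ∈ Ico 2 N₀, (ρ⁻¹ ^ (2 * q + 1 + 1) * κ⁻¹ ^ (2 * (n - 1)) * (α ^ (n - 1) * Real.exp n)) *
              ∑ δ ∈ (Fintype.piFinset fun _ : Fin n => range (Fintype.card (SpaceTimeIdx L M × SectorLeg (sectorCount (d * k - 1))) / 2 + 1)) with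
                  2 * q + 1 + 1 + 2 * (n - 1) ≤ ∑ a, 2 * δ a,
                ∏ a, (Real.exp 2 * (κ + ρ)) ^ (2 * δ a) * (imagTimeWeight β M ^ (2 * δ a) * B (δ a)) +
            ρ⁻¹ ^ (2 * q + 1 + 1) *
              (Real.exp 1 * normV (SpaceTimeIdx L M × SectorLeg (sectorCount (d * k - 1))) κ ρ (fun m' => imagTimeWeight β M ^ (2 * m') * B m')) *
              (Real.exp 1 * α * normV (SpaceTimeIdx L M × SectorLeg (sectorCount (d * k - 1))) κ ρ
                  (fun m' => imagTimeWeight β M ^ (2 * m') * B m') / κ ^ 2) ^ (N₀ - 1) /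
              (1 - Real.exp 1 * α * normV (SpaceTimeIdx L M × SectorLeg (sectorCount (d * k - 1))) κ ρ
                  (fun m' => imagTimeWeight β M ^ (2 * m') * B m') / κ ^ 2)) +
        cr * cc ^ (2 * q + 1) *
          ∑ m' ∈ range (Fintype.card (SpaceTimeIdx L M × SectorLeg (sectorCount (d * k - 1))) / 2 + 1),
            (if q + 1 < m' then ((2 * m').choose (2 * (q + 1)) : ℝ) * κ ^ (2 * m' - 2 * (q + 1)) *
              (imagTimeWeight β M ^ (2 * m') * B m') else 0)) := by
  have hβ' : β ≠ 0 := hβ.ne'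
  have hJ₁ : 1 ≤ d * k := le_trans hd (Nat.le_mul_of_pos_right d hk)
  have hJ : d * k ≤ d * (k + 1) := Nat.mul_le_mul_left d (Nat.le_succ k)
  have hwt := isTreeWeight_klScaleWtPow L M hβ.le jr Dw
  have hG : klTowerInput L M β U μ K d k ∈ evenPart ℂ (HubbardFieldIdx L M) := klEffectiveAction_mem_evenPart hβ' U μ K klE0 (d * k)
  have hG0 : constPart ℂ (klTowerInput L M β U μ K d k) = 0 := constPart_klEffectiveAction_eq_zero β U μ K klE0 (d * k) hZ
  have hε : 0 ≤ imagTimeWeight β M := imagTimeWeight_nonneg hβ.le M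
  -- split the increment and the pinned sum
  have h2 := blockStep_ordersGe2_wt_le (L := L) (M := M) hwt hβ μ K hJ₁ hJ hJ' (latticeLegPos (2 * (2 * M))) (latticeLegPos (2 * (2 * M)))
    (klTowerInput L M β U μ K d k) hG hG0 hκ hGB B hB0 hB hα hrow hcol hρ hθ hcc0 hrow' hcol' hN₀ (2 * q + 1) i w''
  have h1 := blockStep_firstOrder_wt_le (L := L) (M := M) hwt hβ μ K hJ₁ hJ hJ' (latticeLegPos (2 * (2 * M))) (latticeLegPos (2 * (2 * M)))
    (klTowerInput L M β U μ K d k) hG hκ.le hGB B hB0 hB hcc0 hrow' hcol' q i w''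
  rw [klTowerIncr_eq_ordersGe2_add_firstOrder β U μ K d k hZ]
  refine (klWtPinnedSumPow_add_le hβ.le μ K J' jr Dw _ _ _ i w'').trans ?_
  rw [mul_add (imagTimeWeight β M ^ (2 * q + 1))]
  exact add_le_add
    ((klWtPinnedSumPow_succ β μ K J' jr Dw (2 * q + 1) _ i w'').le.trans (mul_le_mul_of_nonneg_left h2 (pow_nonneg hε _)))
    ((klWtPinnedSumPow_succ β μ K J' jr Dw (2 * q + 1) _ i w'').le.trans (mul_le_mul_of_nonneg_left h1 (pow_nonneg hε _)))

end Born

end Summit.HubbardSuperconductivity.HubbardSuperconductivity.Theorems.EngineV8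

end
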